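/-
Copyright: the b2b-balaban T⁴-continuum CRUX team, row NE7b leaf lineage `t4-ne7b-formalise-leaf-05` (gen 161). Project licence.
-/
import Summits.QuantumFields.BalabanUV.T4Continuum.Spine.NE7b.HardStepMonotone
import Summits.QuantumFields.BalabanUV.T4Continuum.Spine.NE7b.QuadraticFibreMinimiser

/-!
# THE SANDWICHED HARD-STEP TOWER, ABSTRACT: over any ℕ-family of Hilbert fibres and blockings with right inverses, a symmetric form
# sandwiched `γ₀·V_k ≤ W_k ≤ γ₁·V_k` at the top flows, along ITS OWN critical sections with any rescaling `c ≥ 0`, between `γ₀·` and `γ₁·` the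
# reference tower AT EVERY LEVEL — leaf-06's HSMO `transported_sandwich` run under induction with a shift of the fibre family (row NE7b, node
# U5c; [folklore] over HSMO and leaf-03's QFM BY NAME; the abstract half of this lineage's BAST, filed separately so that it lands on built parents)

Cell `pub-balaban`, sub-cell `t4`, spine estimate NE7b (`T4WeightBudget.RelWeightBound`; the cell's OWN estimate — NOT PRINTED in
[Bałaban 1983–89], NOT PROVED).  Crux-route work under `Spine/NE7b/` by a row leaf (`t4-ne7b-formalise-leaf-05` gen 161) under FREEZE (0)'s
crux-prover clause.  NOTHING of Bałaban's is asserted; no `T4Continuum/Support` leaf typed; no `def`; zero `sorry`.  Imports: leaf-06's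
`…HardStepMonotone` (HSMO) and leaf-03's `…QuadraticFibreMinimiser` (QFM) only.

WHY (located).  BAUB §4's one-step sandwich (`γ₀·Q ≤ V ≤ γ₁·Q ⟹ γ₀·R ≤ V⁺ ≤ γ₁·γ₁(d)·R`) MULTIPLIES if iterated naively; HSMO's
monotonicity of the hard step (`γ₀·P ≤ Q ≤ γ₁·P ⟹ γ₀·P⁺ ≤ Q⁺ ≤ γ₁·P⁺`, SAME constants) run ALONGSIDE a reference tower does not.  This file is
that induction with nothing of print's torus in it (any Hilbert fibres `X : ℕ → Type u`, any blockings, any rescaling `c ≥ 0`); this lineage's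
`…BlockAverageSandwichTower` (BAST) instantiates it on print's torus next to BATW's free tower.

WHAT IS PROVED ([folklore]):
* §1 (`E` Hilbert, `F`, `G` normed) **`sandwich_step`**: `V′ ≥ 0` and `W′` symmetric, `γ₀·V′ ≤ W′ ≤ γ₁·V′` (`0 ≤ γ₀`), `H` the `V′`-critical and `T`
  the `W′`-critical section of `D` ⟹ for `V = c•V′.bilinearComp H H`, `W = c•W′.bilinearComp T T` (`0 ≤ c`): `γ₀·V ≤ W ≤ γ₁·V`, `W` symmetric,
  `W ≥ 0`; **`nextStep_of_sandwich`**: `γ₀·V ≤ W` (`0 < γ₀`), `V` `m`-coercive on `ker D₂` (`0 < m`), `D₂` with a continuous right inverse ⟹ `W` is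
  `(γ₀m)`-coercive on `ker D₂` and the `W`-critical section of `D₂` EXISTS and is UNIQUE.
* §2 **`exists_sandwich_tower_abstract`** (fibres `X : ℕ → Type u` quantified INSIDE the statement so the induction can shift them): given blockings
  `D j : X (j+1) → X j`, a reference tower `(V, H)` with `V j = c•(V (j+1)).bilinearComp (H j) (H j)` (`H j` `V (j+1)`-critical), floors `m` on
  `ker D j`, symmetry ∕ positivity, and a symmetric top form `W_k` with `γ₀·V k ≤ W_k ≤ γ₁·V k` (`0 < γ₀`): `∃ W T`, `W k = W_k`,
  `W j = c•(W (j+1)).bilinearComp (T j) (T j)` along THE `W (j+1)`-critical section (exists, unique), floor `γ₀·m`, and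
  **`γ₀·V j ≤ W j ≤ γ₁·V j` with `W j` symmetric at every level `j ≤ k`**; toy.

NOT HERE (honest): any instance (print's torus is BAST's §3; sup-norm currencies are not Hilbert and are NOT covered); non-quadratic actions;
anything of Bałaban's.  BY-NAME EFFECT ON THE WALL: NONE.  NE7b NOT PRINTED ∕ NOT PROVED; spine PROVED 0∕9; rung (B)+1 on a FINITE torus — NOT
infinite volume, NOT the mass gap, NOT Clay.  HONEST DEPENDENCY: continuum YM on T⁴ ⇐ BetaPertH ∧ nine spine estimates (0∕9 proved); BetaPertH ⇐
(D1) ∧ (D4) ∧ CAP+tail; G-an2-4 gates asym, D1 and NE2∕3∕4.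
-/

set_option autoImplicit false

namespace Summit.QuantumFields.BalabanUV.T4Continuum.NE7b.HardStepSandwichTower

open Summit.QuantumFields.BalabanUV.T4Continuum.NE7b.QuadraticFibreMinimiser (exists_propagator propagator_unique)
open Summit.QuantumFields.BalabanUV.T4Continuum.NE7b.HardStepMonotone
  (transported_sandwich transported_nonneg_of_dominates bilinearComp_symm)

/-! ## §1. One sandwiched hard step (abstract) -/

section OneStep

variable {E F : Type*} [NormedAddCommGroup E] [InnerProductSpace ℝ E] [NormedAddCommGroup F] [NormedSpace ℝ F]

/-- **THE SANDWICH PASSES A RESCALED HARD STEP WITH THE SAME CONSTANTS.**  `V′ ≥ 0` and `W′` symmetric on `E`, `γ₀·V′ ≤ W′ ≤ γ₁·V′`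
(`0 ≤ γ₀`), `H` the `V′`-critical and `T` the `W′`-critical section of the blocking `D` ⟹ the rescaled transported forms
`V = c•V′.bilinearComp H H`, `W = c•W′.bilinearComp T T` (`0 ≤ c`) satisfy `γ₀·V g g ≤ W g g ≤ γ₁·V g g`, and `W` is symmetric and `≥ 0`
— leaf-06's HSMO `transported_sandwich` BY NAME, times `c`. [folklore] -/
theorem sandwich_step (V' W' : E →L[ℝ] E →L[ℝ] ℝ) (D : E →L[ℝ] F) (H T : F →L[ℝ] E)
    (hVsymm : ∀ u v, V' u v = V' v u) (hVpos : ∀ v, 0 ≤ V' v v) (hWsymm : ∀ u v, W' u v = W' v u)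
    {γ₀ γ₁ : ℝ} (hγ₀ : 0 ≤ γ₀) (hlo : ∀ v, γ₀ * V' v v ≤ W' v v) (hhi : ∀ v, W' v v ≤ γ₁ * V' v v)
    (hH : ∀ g, D (H g) = g) (hHo : ∀ g κ, D κ = 0 → V' (H g) κ = 0)
    (hT : ∀ g, D (T g) = g) (hTo : ∀ g κ, D κ = 0 → W' (T g) κ = 0)
    {c : ℝ} (hc : 0 ≤ c) {V W : F →L[ℝ] F →L[ℝ] ℝ}
    (hV : V = c • V'.bilinearComp H H) (hW : W = c • W'.bilinearComp T T) :
    (∀ g, γ₀ * V g g ≤ W g g) ∧ (∀ g, W g g ≤ γ₁ * V g g) ∧ (∀ g h, W g h = W h g) ∧ (∀ g, 0 ≤ W g g) := by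
  subst hV hW
  have hWpos : ∀ κ, D κ = 0 → 0 ≤ W' κ κ := fun κ _ => (mul_nonneg hγ₀ (hVpos κ)).trans (hlo κ)
  have hsand := fun g =>
    transported_sandwich W' V' D T H hT hH hTo hHo hWsymm hVsymm hWpos (fun κ _ => hVpos κ) hγ₀ hlo hhi g
  refine ⟨fun g => ?_, fun g => ?_, fun g h => ?_, fun g => ?_⟩
  · simp only [_root_.smul_apply, smul_eq_mul]
    calc γ₀ * (c * (V'.bilinearComp H H) g g) = c * (γ₀ * (V'.bilinearComp H H) g g) := by ring
      _ ≤ c * (W'.bilinearComp T T) g g := mul_le_mul_of_nonneg_left (hsand g).1 hc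
  · simp only [_root_.smul_apply, smul_eq_mul]
    calc c * (W'.bilinearComp T T) g g ≤ c * (γ₁ * (V'.bilinearComp H H) g g) := mul_le_mul_of_nonneg_left (hsand g).2 hc
      _ = γ₁ * (c * (V'.bilinearComp H H) g g) := by ring
  · simp only [_root_.smul_apply, smul_eq_mul]
    rw [bilinearComp_symm W' T hWsymm]
  · simp only [_root_.smul_apply, smul_eq_mul]
    exact mul_nonneg hc (transported_nonneg_of_dominates W' V' T hγ₀ hlo hVpos g)

variable [CompleteSpace E] {G : Type*} [NormedAddCommGroup G] [NormedSpace ℝ G]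

/-- **THE SANDWICHED FORM HAS ITS OWN NEXT CRITICAL SECTION.**  `γ₀·V ≤ W` on `E` with `0 < γ₀`, `V` `m`-coercive on `ker D₂` (`0 < m`),
`D₂ : E → G` with a continuous right inverse `S` ⟹ `W` is `(γ₀·m)`-coercive on `ker D₂`, and the `W`-critical section of `D₂` EXISTS (QFM
`exists_propagator`, Lax–Milgram on `ker D₂`) and is UNIQUE (QFM `propagator_unique`). [folklore] -/
theorem nextStep_of_sandwich (V W : E →L[ℝ] E →L[ℝ] ℝ) (D₂ : E →L[ℝ] G)
    {γ₀ m : ℝ} (hγ₀ : 0 < γ₀) (hm : 0 < m) (hlo : ∀ v, γ₀ * V v v ≤ W v v)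
    (hfl : ∀ g, D₂ g = 0 → m * ‖g‖ ^ 2 ≤ V g g) {S : G →L[ℝ] E} (hS : ∀ y, D₂ (S y) = y) :
    (∀ g, D₂ g = 0 → γ₀ * m * ‖g‖ ^ 2 ≤ W g g) ∧
      (∃ T : G →L[ℝ] E, (∀ y, D₂ (T y) = y) ∧ (∀ y κ, D₂ κ = 0 → W (T y) κ = 0)) ∧
      (∀ T T' : G →L[ℝ] E, (∀ y, D₂ (T y) = y) → (∀ y κ, D₂ κ = 0 → W (T y) κ = 0) →
        (∀ y, D₂ (T' y) = y) → (∀ y κ, D₂ κ = 0 → W (T' y) κ = 0) → T = T') := by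
  have hflW : ∀ g, D₂ g = 0 → γ₀ * m * ‖g‖ ^ 2 ≤ W g g := fun g hg =>
    calc γ₀ * m * ‖g‖ ^ 2 = γ₀ * (m * ‖g‖ ^ 2) := by ring
      _ ≤ γ₀ * V g g := mul_le_mul_of_nonneg_left (hfl g hg) hγ₀.le
      _ ≤ W g g := hlo g
  have hγm : 0 < γ₀ * m := mul_pos hγ₀ hm
  obtain ⟨T, hT, hTo, -⟩ := exists_propagator (Q := W) hS hγm hflW
  exact ⟨hflW, ⟨T, hT, hTo⟩, fun T₁ T₂ h₁ h₁o h₂ h₂o => propagator_unique hγm hflW h₁ h₁o h₂ h₂o⟩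

end OneStep

/-! ## §2. The sandwiched tower alongside a free tower (abstract fibres) -/

section AbstractTower

universe u

/-- **THE SANDWICHED TOWER EXISTS, IS UNIQUE, AND STAYS BETWEEN `γ₀·` AND `γ₁·` THE FREE TOWER AT EVERY LEVEL.**  Data: blockings
`D j : X (j+1) → X j`; a free tower `(V, H)` up to level `k` — `H j` the `V (j+1)`-critical section of `D j`,
`V j = c•(V (j+1)).bilinearComp (H j) (H j)`, floors `m` on `ker D j`, every `V j` symmetric and `≥ 0`; a symmetric top form `W_k` with
`γ₀·V k ≤ W_k ≤ γ₁·V k`, `0 < γ₀`, `0 ≤ c`, `0 < m`.  Output: `∃ W T` with `W k = W_k`, the recursion `W j = c•(W (j+1)).bilinearComp (T j) (T j)`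
along THE `W (j+1)`-critical section `T j` of `D j` (exists, unique), the floor `γ₀·m` on `ker D j`, and `γ₀·V j ≤ W j ≤ γ₁·V j` with
`W j` symmetric for every `j ≤ k` — the SAME `(γ₀, γ₁)` at every level.  Induction on `k` over all data: shift, then the coarsest step
by §1. [folklore] -/
theorem exists_sandwich_tower_abstract {c γ₀ γ₁ m : ℝ} (hc : 0 ≤ c) (hγ₀ : 0 < γ₀) (hm : 0 < m) (k : ℕ) :
    ∀ (X : ℕ → Type u) [∀ j, NormedAddCommGroup (X j)] [∀ j, InnerProductSpace ℝ (X j)] [∀ j, CompleteSpace (X j)]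
      (D : ∀ j, X (j + 1) →L[ℝ] X j) (V : ∀ j, X j →L[ℝ] X j →L[ℝ] ℝ) (H : ∀ j, X j →L[ℝ] X (j + 1))
      (Wk : X k →L[ℝ] X k →L[ℝ] ℝ),
      (∀ j, j < k → (∀ g, D j (H j g) = g) ∧ (∀ g κ, D j κ = 0 → V (j + 1) (H j g) κ = 0) ∧
        V j = c • (V (j + 1)).bilinearComp (H j) (H j)) →
      (∀ j, j < k → ∀ g, D j g = 0 → m * ‖g‖ ^ 2 ≤ V (j + 1) g g) →
      (∀ j, j ≤ k → (∀ g h, V j g h = V j h g) ∧ (∀ g, 0 ≤ V j g g)) →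
      (∀ g h, Wk g h = Wk h g) → (∀ g, γ₀ * V k g g ≤ Wk g g) → (∀ g, Wk g g ≤ γ₁ * V k g g) →
      ∃ (W : ∀ j, X j →L[ℝ] X j →L[ℝ] ℝ) (T : ∀ j, X j →L[ℝ] X (j + 1)),
        W k = Wk ∧
        (∀ j, j < k → (∀ g, D j (T j g) = g) ∧ (∀ g κ, D j κ = 0 → W (j + 1) (T j g) κ = 0) ∧
          W j = c • (W (j + 1)).bilinearComp (T j) (T j)) ∧
        (∀ j, j < k → ∀ T' : X j →L[ℝ] X (j + 1),
          (∀ g, D j (T' g) = g) → (∀ g κ, D j κ = 0 → W (j + 1) (T' g) κ = 0) → T' = T j) ∧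
        (∀ j, j < k → ∀ g, D j g = 0 → γ₀ * m * ‖g‖ ^ 2 ≤ W (j + 1) g g) ∧
        (∀ j, j ≤ k → (∀ g, γ₀ * V j g g ≤ W j g g) ∧ (∀ g, W j g g ≤ γ₁ * V j g g) ∧ (∀ g h, W j g h = W j h g)) := by
  induction k with
  | zero =>
    intro X _ _ _ D V H Wk _ _ _ hWsym hlo hhi
    refine ⟨fun j => match j with
        | 0 => Wk
        | j + 1 => 0,
      fun _ => 0, rfl, fun j hj => absurd hj (by omega), fun j hj => absurd hj (by omega),
      fun j hj => absurd hj (by omega), fun j hj => ?_⟩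
    obtain rfl : j = 0 := by omega
    exact ⟨hlo, hhi, hWsym⟩
  | succ k ih =>
    intro X _ _ _ D V H Wk hrec hfl hsym hWsym hlo hhi
    obtain ⟨W', T', htop, hrec', huniq', hfl', hsand'⟩ :=
      ih (fun j => X (j + 1)) (fun j => D (j + 1)) (fun j => V (j + 1)) (fun j => H (j + 1)) Wk
        (fun j hj => hrec (j + 1) (by omega)) (fun j hj => hfl (j + 1) (by omega))
        (fun j hj => hsym (j + 1) (by omega)) hWsym hlo hhi
    -- the new coarsest step, from level `1` (the shifted tower's level `0`) to level `0`
    obtain ⟨hH₀, hH₀o, hV₀⟩ := hrec 0 (by omega)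
    obtain ⟨hlo₁, hhi₁, hWsym₁⟩ := hsand' 0 (by omega)
    obtain ⟨hVsym₁, hVpos₁⟩ := hsym 1 (by omega)
    obtain ⟨hflW, ⟨T₀, hT₀, hT₀o⟩, huniq₀⟩ :=
      nextStep_of_sandwich (V 1) (W' 0) (D 0) hγ₀ hm hlo₁ (hfl 0 (by omega)) hH₀
    obtain ⟨hlo₀, hhi₀, hWsym₀, -⟩ := sandwich_step (V 1) (W' 0) (D 0) (H 0) T₀ hVsym₁ hVpos₁ hWsym₁ hγ₀.le hlo₁ hhi₁
      hH₀ hH₀o hT₀ hT₀o hc hV₀ (rfl : c • (W' 0).bilinearComp T₀ T₀ = _)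
    refine ⟨fun j => match j with
        | 0 => c • (W' 0).bilinearComp T₀ T₀
        | j + 1 => W' j,
      fun j => match j with
        | 0 => T₀
        | j + 1 => T' j,
      htop, ?_, ?_, ?_, ?_⟩
    · intro j hj
      cases j with
      | zero => exact ⟨hT₀, hT₀o, rfl⟩
      | succ j => exact hrec' j (by omega)
    · intro j hj
      cases j with
      | zero => exact fun T'' h₁ h₂ => huniq₀ T'' T₀ h₁ h₂ hT₀ hT₀o
      | succ j => exact huniq' j (by omega)
    · intro j hj
      cases j with
      | zero => exact hflW
      | succ j => exact hfl' j (by omega)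
    · intro j hj
      cases j with
      | zero => exact ⟨hlo₀, hhi₀, hWsym₀⟩
      | succ j => exact hsand' j (by omega)

end AbstractTower

/-- Toy: two levels of the abstract bookkeeping keep `(γ₀, γ₁) = (1∕2, 2)` — not `(1∕4, 4)`. -/
example : ((1 : ℝ) / 2, (2 : ℝ)) = (1 / 2, 2) ∧ ((1 : ℝ) / 2) ^ 2 = 1 / 4 := by norm_num

end Summit.QuantumFields.BalabanUV.T4Continuum.NE7b.HardStepSandwichTower
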